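import Summits.QuantumFields.YangMills.Theorems.ConvexGribovBodyStrongCouplingShape
import HarnessLib

/-!
# Line `Sketch` of crux `ContinuumLegGivenGap` (stmt-QuantumFields-8782): the SUPPORT-GROWTH shape
of the clustering constants holds at strong coupling (calibration of `stub_supportGrowth`)

Support file for the open core `stub_supportGrowth` of line `Sketch` (reshape 5, continuation lead
c2): "at each coupling the volume-uniform clustering constants are of product form
`‖A‖∞ ‖B‖∞ · exp(κ · pairSize A B)`, `pairSize = 1 + #supp A + #supp B + radius(supp A) + radius(supp B)`".
In the one regime where clustering is a THEOREM — Osterwalder–Seiler strong coupling,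
`0 ≤ β ≤ betaOne 4 r.ρ / 4` — the constants delivered by the tree's torus analyticity bound
`abs_latticeConnectedCorr_le` (`2 C_A C_B (2e^{1/2})^{512(#A+#B)} 2^{-(n-2r)}`, behind item
stmt-QuantumFields-8783 `StrongCouplingShape`) ARE of exactly this form, with ONE `κ` and the rate
`log 2` on the whole strong-coupling interval: `supportGrowthShape_strongCoupling`. So the template
of `stub_supportGrowth` is not a guess: it is the shape the only proven clustering mechanism in the
tree produces (exponential in the support cardinalities from the polymer entropy, exponential in the
support radii from the geometric offset `n − 2r`). Corollary `supportGrowthAt_strongCoupling`: the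
conclusion of `stub_supportGrowth` at `(G, r)`, verbatim, on the strong-coupling window.

Tree objects only (`abs_latticeConnectedCorr_le`, `betaOne`); no definitions, no facts.
-/

noncomputable section

namespace Summit.QuantumFields.YangMills.Theorems.ContinuumLegGivenGap

open Literature.MathematicalPhysics.QuantumFieldTheory
open Literature.MathematicalPhysics.QuantumLattice (LGConfig)

/-- The sup norm `⨆ U, |A.F U|` of a local gauge-invariant observable bounds it pointwise (private
copy; the observable is bounded, so the supremum is a genuine one). [folklore] -/
private theorem abs_le_supNorm' {G : Type} [Group G] [MeasurableSpace G] (A : YMSpecies G)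
    (U : LGConfig 4 G) : |A.F U| ≤ ⨆ V, |A.F V| := by
  have hbdd : BddAbove (Set.range fun V => |A.F V|) := by
    obtain ⟨C, hC⟩ := A.bounded
    exact ⟨C, by rintro _ ⟨V, rfl⟩; exact hC V⟩
  exact le_ciSup hbdd U

/-- The time coordinate of a support edge is bounded by the sup-norm radius of the support. [folklore] -/
private theorem natAbs_time_le_radius (Λ : Finset (Literature.MathematicalPhysics.QuantumLattice.ZdEdge 4))
    {e : Literature.MathematicalPhysics.QuantumLattice.ZdEdge 4} (he : e ∈ Λ) :
    (e.1 0).natAbs ≤ Λ.sup (fun e => Finset.univ.sup fun i => (e.1 i).natAbs) := by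
  have h1 : (e.1 0).natAbs ≤ Finset.univ.sup fun i => (e.1 i).natAbs :=
    Finset.le_sup (f := fun i => (e.1 i).natAbs) (Finset.mem_univ (0 : Fin 4))
  exact h1.trans (Finset.le_sup
    (f := fun e : Literature.MathematicalPhysics.QuantumLattice.ZdEdge 4 =>
      Finset.univ.sup fun i => (e.1 i).natAbs) he)

/-- **The support-growth shape at strong coupling, uniformly on the window** (calibration of the open
core `stub_supportGrowth` of line `Sketch`, stmt-QuantumFields-8782): for every compact group `G`
with a lattice representation `r` there are `b = betaOne 4 r.ρ / 4 > 0` and ONE `κ`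
(`2 log 2 + 512 log (2 e^{1/2})`) such that for all `0 ≤ β ≤ b`, all pairs of gauge-invariant local
observables `A, B`, all `S` and all `n ≤ S`,
`|corr_{β,2S+1}(A, B; n)| ≤ ‖A‖∞ ‖B‖∞ · exp(κ · (1 + #supp A + #supp B + R_A + R_B)) · e^{−(log 2) n}`,
`R` the sup-norm radius of the support — Osterwalder–Seiler 1978, Thm. 3.5 on the torus, through the
tree's `abs_latticeConnectedCorr_le`, whose constant `2 C_A C_B (2e^{1/2})^{512(#A+#B)} 2^{2r}`
(`r` = the larger time radius `≤ R_A + R_B`) is dominated termwise. [folklore] -/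
theorem supportGrowthShape_strongCoupling :
    ∀ (G : Type) [Group G] [TopologicalSpace G] [IsTopologicalGroup G] [CompactSpace G]
      [MeasurableSpace G] [BorelSpace G] (r : LatticeRep G),
      ∃ b : ℝ, 0 < b ∧ ∃ κ : ℝ, ∀ β : ℝ, 0 ≤ β → β ≤ b → ∀ A B : YMSpecies G, ∀ S n : ℕ, n ≤ S →
        |latticeConnectedCorr r.ρ β (2 * S + 1) A.F B.F n| ≤
          (⨆ U, |A.F U|) * (⨆ U, |B.F U|) *
            Real.exp (κ * ((1 + A.supp.card + B.supp.card +
              A.supp.sup (fun e => Finset.univ.sup fun i => (e.1 i).natAbs) +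
              B.supp.sup (fun e => Finset.univ.sup fun i => (e.1 i).natAbs) : ℕ) : ℝ)) *
            Real.exp (-(Real.log 2 * n)) := by
  intro G _ _ _ _ _ _ r
  have hb : 0 < betaOne 4 r.ρ := betaOne_pos 4
  -- the entropy constant per support edge and the multiplier
  set k₀ : ℝ := Real.log (2 * Real.exp (1 / 2)) with hk₀
  have hk₀0 : 0 ≤ k₀ := by
    rw [hk₀]; refine Real.log_nonneg ?_
    have := Real.one_lt_exp_iff.2 (by norm_num : (0 : ℝ) < 1 / 2); linarith
  have hl2 : 0 < Real.log 2 := Real.log_pos one_lt_two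
  set κ : ℝ := 2 * Real.log 2 + 2 * (2 ^ 4 * (4 * 4)) * k₀ with hκ
  have hκ0 : 0 ≤ κ := by rw [hκ]; positivity
  refine ⟨betaOne 4 r.ρ / 4, by positivity, κ, fun β hβ0 hβ A B S n hn => ?_⟩
  -- sup norms and radii
  set C_A : ℝ := ⨆ U, |A.F U| with hCA
  set C_B : ℝ := ⨆ U, |B.F U| with hCB
  have hA : ∀ U, |A.F U| ≤ C_A := fun U => abs_le_supNorm' A U
  have hB : ∀ U, |B.F U| ≤ C_B := fun U => abs_le_supNorm' B U
  have hCA0 : 0 ≤ C_A := Real.iSup_nonneg fun U => abs_nonneg _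
  have hCB0 : 0 ≤ C_B := Real.iSup_nonneg fun U => abs_nonneg _
  set R_A : ℕ := A.supp.sup (fun e => Finset.univ.sup fun i => (e.1 i).natAbs) with hRA
  set R_B : ℕ := B.supp.sup (fun e => Finset.univ.sup fun i => (e.1 i).natAbs) with hRB
  set r₀ : ℕ := R_A + R_B with hr₀
  have hrA : ∀ e ∈ A.supp, (e.1 0).natAbs ≤ r₀ := fun e he =>
    (natAbs_time_le_radius A.supp he).trans (Nat.le_add_right _ _)
  have hrB : ∀ e ∈ B.supp, (e.1 0).natAbs ≤ r₀ := fun e he =>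
    (natAbs_time_le_radius B.supp he).trans (Nat.le_add_left _ _)
  -- the tree's torus analyticity bound
  have h := abs_latticeConnectedCorr_le r.continuous A B hA hB hrA hrB hβ0 hβ S n hn
  set q : ℕ := 2 * ((A.supp.card + B.supp.card) * (2 ^ 4 * (4 * 4))) with hq
  set T : ℕ := 1 + A.supp.card + B.supp.card + R_A + R_B with hT
  -- `(1/2)^(n - 2r₀) ≤ 2^(2r₀) e^{-(log 2) n}`
  have hexp : Real.exp (-(Real.log 2 * n)) = ((2 : ℝ) ^ n)⁻¹ := by
    rw [Real.exp_neg, mul_comm, Real.exp_nat_mul, Real.exp_log two_pos]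
  have hmain : ((1 : ℝ) / 2) ^ (n - 2 * r₀) ≤ 2 ^ (2 * r₀) * ((2 : ℝ) ^ n)⁻¹ := by
    -- adapted from `Summit.QuantumFields.YangMills.Theorems.strongCouplingShape_proof`
    rw [le_mul_inv_iff₀ (by positivity)]
    have h2n : (2 : ℝ) ^ n ≤ 2 ^ (n - 2 * r₀) * 2 ^ (2 * r₀) := by
      rw [← pow_add]; exact pow_le_pow_right₀ one_le_two (by omega)
    have hone : ((1 : ℝ) / 2) ^ (n - 2 * r₀) * 2 ^ (n - 2 * r₀) = 1 := by
      rw [← mul_pow]; norm_num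
    calc ((1 : ℝ) / 2) ^ (n - 2 * r₀) * 2 ^ n
        ≤ ((1 : ℝ) / 2) ^ (n - 2 * r₀) * (2 ^ (n - 2 * r₀) * 2 ^ (2 * r₀)) :=
          mul_le_mul_of_nonneg_left h2n (by positivity)
      _ = 2 ^ (2 * r₀) := by rw [← mul_assoc, hone, one_mul]
  -- the structured prefactor `2 · (2e^{1/2})^q · 2^{2r₀}` is dominated by `exp (κ T)`
  have hP : 0 < 2 * Real.exp (1 / 2) := by positivity
  have hpowq : (2 * Real.exp (1 / 2)) ^ q = Real.exp ((q : ℝ) * k₀) := by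
    rw [Real.exp_nat_mul, hk₀, Real.exp_log hP]
  have hpow2 : (2 : ℝ) ^ (2 * r₀) = Real.exp (((2 * r₀ : ℕ) : ℝ) * Real.log 2) := by
    rw [Real.exp_nat_mul, Real.exp_log two_pos]
  have hTr : ((T : ℕ) : ℝ) = 1 + (A.supp.card : ℝ) + (B.supp.card : ℝ) + (R_A : ℝ) + (R_B : ℝ) := by
    simp only [hT]; push_cast; ring
  have hqr : ((q : ℕ) : ℝ) = 512 * ((A.supp.card : ℝ) + (B.supp.card : ℝ)) := by
    simp only [hq]; push_cast; ring
  have hr₀r : ((2 * r₀ : ℕ) : ℝ) = 2 * ((R_A : ℝ) + (R_B : ℝ)) := by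
    simp only [hr₀]; push_cast; ring
  have hkey : Real.log 2 + (q : ℝ) * k₀ + ((2 * r₀ : ℕ) : ℝ) * Real.log 2 ≤ κ * (T : ℝ) := by
    rw [hTr, hqr, hr₀r, hκ]
    have h1 : 0 ≤ (A.supp.card : ℝ) + (B.supp.card : ℝ) := by positivity
    have h2 : 0 ≤ (R_A : ℝ) + (R_B : ℝ) := by positivity
    nlinarith [mul_nonneg hl2.le h1, mul_nonneg hk₀0 h2, mul_nonneg hk₀0 h1, mul_nonneg hl2.le h2]
  have hdom : 2 * (2 * Real.exp (1 / 2)) ^ q * (2 : ℝ) ^ (2 * r₀) ≤ Real.exp (κ * (T : ℝ)) :=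
    calc 2 * (2 * Real.exp (1 / 2)) ^ q * (2 : ℝ) ^ (2 * r₀)
        = Real.exp (Real.log 2) * Real.exp ((q : ℝ) * k₀) *
            Real.exp (((2 * r₀ : ℕ) : ℝ) * Real.log 2) := by
          rw [hpowq, hpow2, Real.exp_log two_pos]
      _ = Real.exp (Real.log 2 + (q : ℝ) * k₀ + ((2 * r₀ : ℕ) : ℝ) * Real.log 2) := by
          rw [Real.exp_add, Real.exp_add]
      _ ≤ Real.exp (κ * (T : ℝ)) := Real.exp_le_exp.2 hkey
  -- assemble
  have hpre0 : 0 ≤ 2 * C_A * C_B * (2 * Real.exp (1 / 2)) ^ q := by positivity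
  calc |latticeConnectedCorr r.ρ β (2 * S + 1) A.F B.F n|
      ≤ 2 * C_A * C_B * (2 * Real.exp (1 / 2)) ^ q * (1 / 2) ^ (n - 2 * r₀) := h
    _ ≤ 2 * C_A * C_B * (2 * Real.exp (1 / 2)) ^ q * (2 ^ (2 * r₀) * ((2 : ℝ) ^ n)⁻¹) :=
        mul_le_mul_of_nonneg_left hmain hpre0
    _ = C_A * C_B * (2 * (2 * Real.exp (1 / 2)) ^ q * (2 : ℝ) ^ (2 * r₀)) *
          Real.exp (-(Real.log 2 * n)) := by
        rw [hexp]; ring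
    _ ≤ C_A * C_B * Real.exp (κ * (T : ℝ)) * Real.exp (-(Real.log 2 * n)) := by
        apply mul_le_mul_of_nonneg_right _ (Real.exp_pos _).le
        exact mul_le_mul_of_nonneg_left hdom (mul_nonneg hCA0 hCB0)

/-- **The conclusion of `stub_supportGrowth` at `(G, r)`, verbatim, on the strong-coupling window**
(corollary; rate `log 2`, one `κ` for the whole window). [folklore] -/
theorem supportGrowthAt_strongCoupling :
    ∀ (G : Type) [Group G] [TopologicalSpace G] [IsTopologicalGroup G] [CompactSpace G]
      [MeasurableSpace G] [BorelSpace G] (r : LatticeRep G),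
      ∃ b : ℝ, 0 < b ∧ ∀ β : ℝ, 0 ≤ β → β ≤ b → ∃ m : ℝ, 0 < m ∧ ∃ κ : ℝ,
        ∀ A B : YMSpecies G, ∀ S n : ℕ, n ≤ S →
          |latticeConnectedCorr r.ρ β (2 * S + 1) A.F B.F n| ≤
            (⨆ U, |A.F U|) * (⨆ U, |B.F U|) *
              Real.exp (κ * ((1 + A.supp.card + B.supp.card +
                A.supp.sup (fun e => Finset.univ.sup fun i => (e.1 i).natAbs) +
                B.supp.sup (fun e => Finset.univ.sup fun i => (e.1 i).natAbs) : ℕ) : ℝ)) *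
              Real.exp (-(m * n)) := by
  intro G _ _ _ _ _ _ r
  obtain ⟨b, hb, κ, h⟩ := supportGrowthShape_strongCoupling G r
  exact ⟨b, hb, fun β h0 h1 => ⟨Real.log 2, Real.log_pos one_lt_two, κ, h β h0 h1⟩⟩

end Summit.QuantumFields.YangMills.Theorems.ContinuumLegGivenGap

end
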